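import Mathlib
import Literature.NumberTheory.LFunctions.Zhang2022.TypedSection15B
import Literature.NumberTheory.LFunctions.Zhang2022.AppendixALocalSeries
import HarnessLib

/-!
# Zhang (2022), §15 p. 84: `𝓜₁(d,l;s)` is analytic for `σ > 9/10` — the edge
# `§15.u034 (analyticity) ⇐ §15.u032 ∧ §15.u033`, kernel-checked

Topic `Literature/NumberTheory/LFunctions/Zhang2022` (Landau–Siegel audit tree; verdict-neutral).
Y. Zhang, *Discrete mean estimates and the Landau–Siegel zero*, arXiv:2211.02515v1 (2022)
[Zhang2022LandauSiegel] — **an unrefereed manuscript under adjudication; nothing here asserts or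
denies its Theorems 1–2.** Campaign D-0069, DAG node `Z22:§15.u034` [Z22 p.84, tex L4199–L4212]:

> [for `(q,dl) = 1` the `q`-factor is] `= 1 + O(q^{−19/10})` for `σ > 9/10`. In case `(q,dl) > 1`
> and `σ > 9/10`, the left side above is trivially `1 + O(q^{−9/10})`. It follows that the function
> `𝓜₁(d,l;s) := ζ(s)L(s,χ)ζ(s+β₁)⁻¹ζ(s+β₂)⁻¹ Σ_n λ̃₁(n,d)ξ₁(n;d,l)n^{−s}` is analytic … for `σ > 9/10`.

The typed file `TypedSection15B` DEFINES `𝓜₁ = calM1` as the Euler product `∏'_q calM1Factor q`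
and states the two local estimates as `Step15_u032`, `Step15_u033` and the conclusion as
`Step15_u034an` (the product converges and `s ↦ 𝓜₁(d,l;s)` is holomorphic on `σ > 9/10`). This file
PROVES the implication (theorems only, no new definitions, no facts):

* `norm_kappaTilde1_prime_pow_le` — `|κ̃₁(qʲ; m, 1)| ≤ Z₂(j+1)²`, `Z₂ = Σ_k (k+1)²2^{−k}`, from
  `𝔫(qʲ) = {qᵏ}` (`AppendixALocal.tsum_nset_prime_pow`) and `|κ₁(qᵏ)| ≤ (k+1)²`
  (`MeanSquareMajorant.norm_kappa₁_prime_pow_le`);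
* `norm_xi1_prime_pow_le` — `|ξ₁(qʳ;d,l)| ≤ 4Z₂(r+1)³` (divisors `qⁱ` of `qʳ`, `μ(qⁱ) = 0` for
  `i ≥ 2`, `q/φ(q) ≤ 2`);
* `differentiableOn_xi1LocalSeries`, `differentiableOn_calM1Factor` — each local factor is
  holomorphic on `σ > 9/10` (the `r`-series is normally convergent there; the denominators
  `(1 − q^{−s})(1 − χ(q)q^{−s})` do not vanish);
* `differentiableOn_tprod_of_summable_bound` — a product `∏'_i F_i(s)` of holomorphic factors with
  `‖F_i(s) − 1‖ ≤ b_i` on an open `U`, `Σ b_i < ∞`, converges (Mathlib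
  `multipliable_one_add_of_summable`) and is holomorphic on `U` (uniform convergence of the finite
  partial products, `TendstoLocallyUniformlyOn.differentiableOn`);
* **`step15_u034an_of : Step15_u032 c′ → Step15_u033 c′ → Step15_u034an c′`** — with
  `b_q = C₃₂q^{−19/10} + [q ∣ dl]·C₃₃q^{−9/10}` (finitely many `q ∣ dl`).

WHAT THIS IS NOT: a proof of `Step15_u032`/`Step15_u033` (they remain CLAIMS), or of anything about
Theorems 1–2 / Landau–Siegel zeros.

## References

* Y. Zhang, arXiv:2211.02515v1 (2022), §15 p. 84. [cite: Zhang2022LandauSiegel, §15 p. 84]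
-/

noncomputable section

open Complex Real Filter Topology

namespace Literature.NumberTheory.LFunctions.Zhang2022.Typed.Section15B

open Literature.NumberTheory.LFunctions.Zhang2022
open Literature.NumberTheory.LFunctions.Zhang2022.Typed.Section15A

/-! ## The constant `Z₂ = Σ_k (k+1)² 2^{−k}` -/

/-- `Σ_k (k+1)² 2^{−k}` converges. [folklore] -/
private theorem summable_sq_geom : Summable (fun k : ℕ => ((k : ℝ) + 1) ^ 2 * (1 / 2 : ℝ) ^ k) := by
  have h : Summable (fun n : ℕ => (n : ℝ) ^ 2 * (1 / 2 : ℝ) ^ n) :=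
    summable_pow_mul_geometric_of_norm_lt_one 2 (by norm_num)
  have h2 : Summable (fun n : ℕ => (((n + 1 : ℕ) : ℝ)) ^ 2 * (1 / 2 : ℝ) ^ (n + 1)) :=
    (summable_nat_add_iff 1).mpr h
  refine (h2.mul_left 2).congr fun n => ?_
  push_cast
  rw [pow_succ]
  ring

/-! ## `κ̃₁` at prime powers -/

/-- **`|κ̃₁(qʲ; m, 1)| ≤ Z₂(j+1)²`** for a prime `q`, any `j` and any coprimality modulus `m`, with
`Z₂ = Σ_k (k+1)²2^{−k}`: the series over `h ∈ 𝔫(qʲ)` runs over `h = qᵏ` (for `j = 0` only `h = 1`),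
`|κ₁(q^{j+k})| ≤ (j+k+1)² ≤ (j+1)²(k+1)²` and `q^{−k} ≤ 2^{−k}`.
[cite: Zhang2022LandauSiegel, §15 (15.9) p. 82] -/
theorem norm_kappaTilde1_prime_pow_le (c' : ℝ) {D : ℕ} (χ : DirichletCharacter ℂ D) {q : ℕ}
    (hq : q.Prime) (j m : ℕ) :
    ‖kappaTilde1 c' χ (q ^ j) m 1‖ ≤
      (∑' k : ℕ, ((k : ℝ) + 1) ^ 2 * (1 / 2 : ℝ) ^ k) * ((j : ℝ) + 1) ^ 2 := by
  classical
  set Z₂ : ℝ := ∑' k : ℕ, ((k : ℝ) + 1) ^ 2 * (1 / 2 : ℝ) ^ k with hZ₂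
  have hZ₂1 : 1 ≤ Z₂ :=
    calc (1 : ℝ) = (((0 : ℕ) : ℝ) + 1) ^ 2 * (1 / 2 : ℝ) ^ (0 : ℕ) := by norm_num
      _ ≤ Z₂ := summable_sq_geom.le_tsum 0 (fun k _ => by positivity)
  rcases Nat.eq_zero_or_pos j with rfl | hj
  · -- `j = 0`: `κ̃₁(1; m, 1) = κ₁(1) = 1`
    have h1 : kappaTilde1 c' χ (q ^ 0) m 1 = 1 := by
      rw [pow_zero]
      unfold kappaTilde1
      rw [AppendixALocal.tsum_nset_one m]
      have hk : kappa1 c' D 1 = 1 := (MeanSquareMajorant.isMultiplicative_kappa₁ _ _).map_one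
      simp [hk]
    rw [h1, norm_one]
    simpa using hZ₂1
  · -- `j ≥ 1`: reindex over `h = qᵏ`
    unfold kappaTilde1
    rw [AppendixALocal.tsum_nset_prime_pow hq hj.ne' m]
    set g : ℕ → ℂ := fun k => if Nat.Coprime (q ^ k) m then
      kappa1 c' D (q ^ j * q ^ k) * χ ((q ^ k : ℕ) : ZMod D) / ((q ^ k : ℕ) : ℂ) ^ (1 : ℂ) else 0
      with hg
    have hbound : ∀ k, ‖g k‖ ≤ ((j : ℝ) + 1) ^ 2 * (((k : ℝ) + 1) ^ 2 * (1 / 2 : ℝ) ^ k) := by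
      intro k
      have hqk : (0 : ℝ) < (q : ℝ) ^ k := pow_pos (by exact_mod_cast hq.pos) k
      have hκ : ‖kappa1 c' D (q ^ j * q ^ k)‖ ≤ ((j : ℝ) + k + 1) ^ 2 := by
        rw [← pow_add]
        have := MeanSquareMajorant.norm_kappa₁_prime_pow_le (Skeleton.b1 c' D) (Skeleton.b2 c' D)
          hq (j + k)
        unfold kappa1
        calc ‖MeanSquareMajorant.kappa₁ (Skeleton.b1 c' D) (Skeleton.b2 c' D) (q ^ (j + k))‖
            ≤ (((j + k : ℕ) : ℝ) + 1) ^ 2 := this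
          _ = ((j : ℝ) + k + 1) ^ 2 := by push_cast; ring
      have hχ : ‖χ ((q ^ k : ℕ) : ZMod D)‖ ≤ 1 := DirichletCharacter.norm_le_one χ _
      have hden : ‖((q ^ k : ℕ) : ℂ) ^ (1 : ℂ)‖ = (q : ℝ) ^ k := by
        rw [cpow_one, Complex.norm_natCast, Nat.cast_pow]
      have hterm : ‖kappa1 c' D (q ^ j * q ^ k) * χ ((q ^ k : ℕ) : ZMod D) /
          ((q ^ k : ℕ) : ℂ) ^ (1 : ℂ)‖ ≤ ((j : ℝ) + k + 1) ^ 2 / (q : ℝ) ^ k := by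
        rw [norm_div, norm_mul, hden, div_le_div_iff_of_pos_right hqk]
        calc ‖kappa1 c' D (q ^ j * q ^ k)‖ * ‖χ ((q ^ k : ℕ) : ZMod D)‖
            ≤ ((j : ℝ) + k + 1) ^ 2 * 1 := by gcongr
          _ = ((j : ℝ) + k + 1) ^ 2 := mul_one _
      have hjk : ((j : ℝ) + k + 1) ^ 2 ≤ ((j : ℝ) + 1) ^ 2 * ((k : ℝ) + 1) ^ 2 := by
        rw [← mul_pow]
        have hj0 : (0 : ℝ) ≤ j := Nat.cast_nonneg j
        have hk0 : (0 : ℝ) ≤ k := Nat.cast_nonneg k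
        exact pow_le_pow_left₀ (by positivity) (by nlinarith) 2
      have hq2 : (1 : ℝ) / (q : ℝ) ^ k ≤ (1 / 2 : ℝ) ^ k := by
        rw [one_div, ← inv_pow, one_div]
        exact pow_le_pow_left₀ (by positivity)
          (inv_anti₀ (by norm_num) (by exact_mod_cast hq.two_le)) k
      simp only [hg]
      split_ifs
      · calc ‖kappa1 c' D (q ^ j * q ^ k) * χ ((q ^ k : ℕ) : ZMod D) / ((q ^ k : ℕ) : ℂ) ^ (1 : ℂ)‖
            ≤ ((j : ℝ) + k + 1) ^ 2 / (q : ℝ) ^ k := hterm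
          _ = ((j : ℝ) + k + 1) ^ 2 * (1 / (q : ℝ) ^ k) := by ring
          _ ≤ (((j : ℝ) + 1) ^ 2 * ((k : ℝ) + 1) ^ 2) * (1 / 2 : ℝ) ^ k := by gcongr
          _ = ((j : ℝ) + 1) ^ 2 * (((k : ℝ) + 1) ^ 2 * (1 / 2 : ℝ) ^ k) := by ring
      · rw [norm_zero]; positivity
    have hsum : Summable fun k => ‖g k‖ :=
      Summable.of_nonneg_of_le (fun _ => norm_nonneg _) hbound (summable_sq_geom.mul_left _)
    calc ‖∑' k, g k‖ ≤ ∑' k, ‖g k‖ := norm_tsum_le_tsum_norm hsum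
      _ ≤ ∑' k : ℕ, ((j : ℝ) + 1) ^ 2 * (((k : ℝ) + 1) ^ 2 * (1 / 2 : ℝ) ^ k) :=
          hsum.tsum_le_tsum hbound (summable_sq_geom.mul_left _)
      _ = Z₂ * ((j : ℝ) + 1) ^ 2 := by rw [tsum_mul_left, hZ₂]; ring

/-! ## `ξ₁` at prime powers -/

/-- `‖μ(k)‖ ≤ 1` (as a complex number). [folklore] -/
private theorem norm_moebius_cast_le_one (k : ℕ) : ‖(ArithmeticFunction.moebius k : ℂ)‖ ≤ 1 := by
  rw [Complex.norm_intCast]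
  exact_mod_cast ArithmeticFunction.abs_moebius_le_one

/-- **`|ξ₁(qʳ;d,l)| ≤ 4Z₂(r+1)³`** for a prime `q` and any `d, l, r`: the divisors of `qʳ` are the
`qⁱ`, `i ≤ r`; the terms with `i ≥ 2` vanish (`μ(qⁱ) = 0`), and for `k ∈ {1, q}` the weight
`|μ(k)χ(k)k/φ(k)| ≤ 2` while `|κ̃₁(q^{r−i}; dk, 1)| ≤ Z₂(r+1)²` — so each of the `r + 1` divisor terms
is at most `2Z₂(r+1)²`. [cite: Zhang2022LandauSiegel, §15 (15.13) p. 83] -/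
theorem norm_xi1_prime_pow_le (c' : ℝ) {D : ℕ} (χ : DirichletCharacter ℂ D) {q : ℕ}
    (hq : q.Prime) (d l r : ℕ) :
    ‖xi1 c' χ (q ^ r) d l‖ ≤
      4 * (∑' k : ℕ, ((k : ℝ) + 1) ^ 2 * (1 / 2 : ℝ) ^ k) * ((r : ℝ) + 1) ^ 3 := by
  classical
  set Z₂ : ℝ := ∑' k : ℕ, ((k : ℝ) + 1) ^ 2 * (1 / 2 : ℝ) ^ k with hZ₂
  have hZ₂0 : 0 ≤ Z₂ := tsum_nonneg fun k => by positivity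
  have hr1 : (1 : ℝ) ≤ (r : ℝ) + 1 := by
    have : (0 : ℝ) ≤ r := Nat.cast_nonneg r
    linarith
  -- every divisor term is at most `2Z₂(r+1)²`
  have hterm : ∀ k ∈ (q ^ r).divisors,
      ‖(ArithmeticFunction.moebius k : ℂ) * χ (k : ZMod D) * (k : ℂ) / (Nat.totient k : ℂ) *
          kappaTilde1 c' χ (q ^ r / k) (d * k) 1‖ ≤ 2 * Z₂ * ((r : ℝ) + 1) ^ 2 := by
    intro k hk
    obtain ⟨i, hi, rfl⟩ := (Nat.mem_divisors_prime_pow hq r).mp hk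
    have hdiv : q ^ r / q ^ i = q ^ (r - i) := Nat.pow_div hi hq.pos
    have hκ : ‖kappaTilde1 c' χ (q ^ r / q ^ i) (d * q ^ i) 1‖ ≤ Z₂ * ((r : ℝ) + 1) ^ 2 := by
      rw [hdiv]
      refine (norm_kappaTilde1_prime_pow_le c' χ hq (r - i) (d * q ^ i)).trans ?_
      have : ((r - i : ℕ) : ℝ) + 1 ≤ (r : ℝ) + 1 := by
        have := Nat.sub_le r i
        exact_mod_cast Nat.succ_le_succ this
      gcongr
    rcases Nat.eq_zero_or_pos i with rfl | hi0
    · -- `k = 1`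
      simp only [pow_zero, Nat.cast_one, ArithmeticFunction.moebius_apply_one, Int.cast_one,
        Nat.totient_one, one_mul, div_one, map_one] at hκ ⊢
      calc ‖kappaTilde1 c' χ (q ^ r / 1) (d * 1) 1‖ ≤ Z₂ * ((r : ℝ) + 1) ^ 2 := hκ
        _ ≤ 2 * Z₂ * ((r : ℝ) + 1) ^ 2 := by nlinarith [pow_nonneg (by positivity : (0:ℝ) ≤ (r:ℝ)+1) 2]
    · by_cases hi1 : i = 1
      · -- `k = q`
        subst hi1
        have hμ : ‖(ArithmeticFunction.moebius (q ^ 1) : ℂ)‖ ≤ 1 := norm_moebius_cast_le_one _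
        have hχ : ‖χ ((q ^ 1 : ℕ) : ZMod D)‖ ≤ 1 := DirichletCharacter.norm_le_one χ _
        have hφ : ‖((q ^ 1 : ℕ) : ℂ) / (Nat.totient (q ^ 1) : ℂ)‖ ≤ 2 := by
          rw [pow_one, Nat.totient_prime hq]
          have hq2 : (2 : ℝ) ≤ q := by exact_mod_cast hq.two_le
          have hq1 : ((q - 1 : ℕ) : ℂ) = (q : ℂ) - 1 := by
            rw [Nat.cast_sub hq.one_lt.le, Nat.cast_one]
          rw [hq1, norm_div, Complex.norm_natCast]
          have hn : ‖(q : ℂ) - 1‖ = (q : ℝ) - 1 := by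
            rw [show (q : ℂ) - 1 = ((q - 1 : ℝ) : ℂ) by push_cast; ring, Complex.norm_real,
              Real.norm_eq_abs, abs_of_nonneg (by linarith)]
          rw [hn, div_le_iff₀ (by linarith)]
          linarith
        calc ‖(ArithmeticFunction.moebius (q ^ 1) : ℂ) * χ ((q ^ 1 : ℕ) : ZMod D) *
              ((q ^ 1 : ℕ) : ℂ) / (Nat.totient (q ^ 1) : ℂ) * kappaTilde1 c' χ (q ^ r / q ^ 1) (d * q ^ 1) 1‖
            = ‖(ArithmeticFunction.moebius (q ^ 1) : ℂ)‖ * ‖χ ((q ^ 1 : ℕ) : ZMod D)‖ *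
                ‖((q ^ 1 : ℕ) : ℂ) / (Nat.totient (q ^ 1) : ℂ)‖ *
                ‖kappaTilde1 c' χ (q ^ r / q ^ 1) (d * q ^ 1) 1‖ := by
              rw [← norm_mul, ← norm_mul, ← norm_mul]; ring_nf
          _ ≤ 1 * 1 * 2 * (Z₂ * ((r : ℝ) + 1) ^ 2) := by
              gcongr
          _ = 2 * Z₂ * ((r : ℝ) + 1) ^ 2 := by ring
      · -- `i ≥ 2`: `μ(qⁱ) = 0`
        have hμ0 : (ArithmeticFunction.moebius (q ^ i) : ℂ) = 0 := by
          rw [ArithmeticFunction.moebius_apply_prime_pow hq hi0.ne', if_neg hi1, Int.cast_zero]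
        rw [hμ0]
        simp only [zero_mul, zero_div, norm_zero]
        positivity
  have hcard : ((q ^ r).divisors.filter fun k => Nat.Coprime k l).card ≤ r + 1 := by
    calc ((q ^ r).divisors.filter fun k => Nat.Coprime k l).card ≤ (q ^ r).divisors.card :=
          Finset.card_filter_le _ _
      _ = r + 1 := by rw [Nat.divisors_prime_pow hq, Finset.card_map, Finset.card_range]
  unfold xi1
  calc ‖∑ k ∈ (q ^ r).divisors.filter (fun k => Nat.Coprime k l),
          (ArithmeticFunction.moebius k : ℂ) * χ (k : ZMod D) * (k : ℂ) / (Nat.totient k : ℂ) *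
            kappaTilde1 c' χ (q ^ r / k) (d * k) 1‖
      ≤ ∑ k ∈ (q ^ r).divisors.filter (fun k => Nat.Coprime k l),
          ‖(ArithmeticFunction.moebius k : ℂ) * χ (k : ZMod D) * (k : ℂ) / (Nat.totient k : ℂ) *
            kappaTilde1 c' χ (q ^ r / k) (d * k) 1‖ := norm_sum_le _ _
    _ ≤ ∑ k ∈ (q ^ r).divisors.filter (fun k => Nat.Coprime k l), 2 * Z₂ * ((r : ℝ) + 1) ^ 2 :=
        Finset.sum_le_sum fun k hk => hterm k (Finset.mem_filter.mp hk).1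
    _ = ((q ^ r).divisors.filter fun k => Nat.Coprime k l).card * (2 * Z₂ * ((r : ℝ) + 1) ^ 2) := by
        rw [Finset.sum_const, nsmul_eq_mul]
    _ ≤ ((r : ℝ) + 1) * (2 * Z₂ * ((r : ℝ) + 1) ^ 2) := by
        gcongr
        exact_mod_cast hcard
    _ = 2 * Z₂ * ((r : ℝ) + 1) ^ 3 := by ring
    _ ≤ 4 * Z₂ * ((r : ℝ) + 1) ^ 3 := by
        nlinarith [pow_nonneg (by positivity : (0 : ℝ) ≤ (r : ℝ) + 1) 3]

/-! ## Holomorphy of the local factors on `σ > 9/10` -/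

/-- The half-plane `σ > 9/10` is open. [folklore] -/
private theorem isOpen_U : IsOpen {s : ℂ | 9 / 10 < s.re} :=
  isOpen_lt continuous_const Complex.continuous_re

/-- **The local series `Σ_{r≥1} ξ₁(qʳ;d,l)q^{−rs}` is holomorphic on `σ > 9/10`** (normally
convergent: `|ξ₁(qʳ)q^{−rs}| ≤ 4Z₂(r+1)³q^{−9r/10}`). [cite: Zhang2022LandauSiegel, §15 p. 84] -/
theorem differentiableOn_xi1LocalSeries (c' : ℝ) {D : ℕ} (χ : DirichletCharacter ℂ D) {q : ℕ}
    (hq : q.Prime) (d l : ℕ) :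
    DifferentiableOn ℂ (xi1LocalSeries c' χ q d l) {s : ℂ | 9 / 10 < s.re} := by
  classical
  set Z₂ : ℝ := ∑' k : ℕ, ((k : ℝ) + 1) ^ 2 * (1 / 2 : ℝ) ^ k with hZ₂
  have hZ₂0 : 0 ≤ Z₂ := tsum_nonneg fun k => by positivity
  have hq0 : (0 : ℝ) < q := by exact_mod_cast hq.pos
  have hq1 : (1 : ℝ) ≤ q := by exact_mod_cast hq.one_lt.le
  have hqC : (q : ℂ) ≠ 0 := by exact_mod_cast hq.ne_zero
  set ρ : ℝ := (q : ℝ) ^ (-(9 / 10 : ℝ)) with hρ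
  have hρ0 : 0 ≤ ρ := Real.rpow_nonneg hq0.le _
  have hρ1 : ρ < 1 := Real.rpow_lt_one_of_one_lt_of_neg (by exact_mod_cast hq.one_lt) (by norm_num)
  -- the summands and their majorant
  set F : ℕ → ℂ → ℂ := fun r s =>
    if r = 0 then 0 else xi1 c' χ (q ^ r) d l / (q : ℂ) ^ ((r : ℂ) * s) with hF
  set u : ℕ → ℝ := fun r => 4 * Z₂ * ((r : ℝ) + 1) ^ 3 * ρ ^ r with hu
  have hu_sum : Summable u := by
    have h : Summable (fun n : ℕ => (n : ℝ) ^ 3 * ρ ^ n) :=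
      summable_pow_mul_geometric_of_norm_lt_one 3 (by rw [Real.norm_eq_abs, abs_of_nonneg hρ0]; exact hρ1)
    have h2 : Summable (fun n : ℕ => (((n + 1 : ℕ) : ℝ)) ^ 3 * ρ ^ (n + 1)) :=
      (summable_nat_add_iff 1).mpr h
    have h3 : Summable (fun n : ℕ => ((n : ℝ) + 1) ^ 3 * ρ ^ n * ρ) := by
      refine h2.congr fun n => ?_
      push_cast; ring
    rcases eq_or_lt_of_le hρ0 with hρz | hρpos
    · -- `ρ = 0` is impossible (`q ≥ 2`), but the majorant is then trivially summable anyway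
      refine summable_of_ne_finset_zero (s := {0}) fun r hr => ?_
      have hr0 : r ≠ 0 := by simpa using hr
      simp [hu, ← hρz, zero_pow hr0]
    · have hρne : ρ ≠ 0 := hρpos.ne'
      have := (h3.mul_right ρ⁻¹).mul_left (4 * Z₂)
      refine this.congr fun n => ?_
      simp only [hu, mul_inv_cancel_right₀ hρne]
      ring
  have hF_diff : ∀ r, DifferentiableOn ℂ (F r) {s : ℂ | 9 / 10 < s.re} := by
    intro r
    simp only [hF]
    split_ifs
    · exact differentiableOn_const _
    · refine DifferentiableOn.div (differentiableOn_const _) ?_ fun s _ => ?_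
      · intro s _
        exact ((differentiableAt_id.const_mul (r : ℂ)).const_cpow (Or.inl hqC)).differentiableWithinAt
      · exact fun h => hqC (Complex.cpow_eq_zero_iff _ _ |>.mp h).1
  have hF_le : ∀ (r : ℕ) (s : ℂ), s ∈ {s : ℂ | 9 / 10 < s.re} → ‖F r s‖ ≤ u r := by
    intro r s hs
    have hs' : 9 / 10 < s.re := hs
    simp only [hF, hu]
    split_ifs with hr
    · rw [norm_zero]; positivity
    · have hden : ‖(q : ℂ) ^ ((r : ℂ) * s)‖ = (q : ℝ) ^ ((r : ℝ) * s.re) := by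
        rw [Complex.norm_natCast_cpow_of_pos hq.pos]
        congr 1
        simp
      have hlow : (q : ℝ) ^ ((r : ℝ) * (9 / 10)) ≤ (q : ℝ) ^ ((r : ℝ) * s.re) :=
        Real.rpow_le_rpow_of_exponent_le hq1 (by
          have : (0 : ℝ) ≤ r := Nat.cast_nonneg r
          nlinarith)
      have hpos : 0 < (q : ℝ) ^ ((r : ℝ) * (9 / 10)) := Real.rpow_pos_of_pos hq0 _
      have hρr : ρ ^ r = ((q : ℝ) ^ ((r : ℝ) * (9 / 10)))⁻¹ := by
        rw [hρ, ← Real.rpow_natCast, ← Real.rpow_mul hq0.le, ← Real.rpow_neg hq0.le]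
        congr 1; ring
      rw [norm_div, hden]
      calc ‖xi1 c' χ (q ^ r) d l‖ / (q : ℝ) ^ ((r : ℝ) * s.re)
          ≤ (4 * Z₂ * ((r : ℝ) + 1) ^ 3) / (q : ℝ) ^ ((r : ℝ) * (9 / 10)) := by
            gcongr
            exact norm_xi1_prime_pow_le c' χ hq d l r
        _ = 4 * Z₂ * ((r : ℝ) + 1) ^ 3 * ρ ^ r := by rw [hρr, div_eq_mul_inv]
  have key := differentiableOn_tsum_of_summable_norm hu_sum hF_diff isOpen_U hF_le
  have hfun : xi1LocalSeries c' χ q d l = fun s => ∑' r, F r s := by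
    funext s; rfl
  rw [hfun]
  exact key

/-- For `σ > 0` and `q ≥ 2`: `‖q^{−s}‖ < 1`, so `1 − q^{−s} ≠ 0` and `1 − χ(q)q^{−s} ≠ 0`.
[folklore] -/
private theorem one_sub_ne_zero_of_norm_lt {z w : ℂ} (hw : ‖w‖ ≤ 1) (hz : ‖z‖ < 1) :
    1 - w * z ≠ 0 := by
  intro h
  have h1 : w * z = 1 := by linear_combination -h
  have : ‖w * z‖ < 1 := by
    rw [norm_mul]
    calc ‖w‖ * ‖z‖ ≤ 1 * ‖z‖ := by gcongr
      _ = ‖z‖ := one_mul _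
      _ < 1 := hz
  rw [h1, norm_one] at this
  exact lt_irrefl _ this

/-- **Each local factor `calM1Factor q d l ·` is holomorphic on `σ > 9/10`.**
[cite: Zhang2022LandauSiegel, §15 p. 84] -/
theorem differentiableOn_calM1Factor (c' : ℝ) {D : ℕ} (χ : DirichletCharacter ℂ D) {q : ℕ}
    (hq : q.Prime) (d l : ℕ) :
    DifferentiableOn ℂ (fun s => calM1Factor c' χ q d l s) {s : ℂ | 9 / 10 < s.re} := by
  have hqC : (q : ℂ) ≠ 0 := by exact_mod_cast hq.ne_zero
  have hcpow : ∀ β : ℂ, DifferentiableOn ℂ (fun s : ℂ => (q : ℂ) ^ (-(s + β))) {s : ℂ | 9 / 10 < s.re} :=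
    fun β s _ =>
      (((differentiableAt_id.add_const β).neg).const_cpow (Or.inl hqC)).differentiableWithinAt
  have hcpow0 : DifferentiableOn ℂ (fun s : ℂ => (q : ℂ) ^ (-s)) {s : ℂ | 9 / 10 < s.re} :=
    fun s _ => ((differentiableAt_id.neg).const_cpow (Or.inl hqC)).differentiableWithinAt
  have hden : ∀ s ∈ {s : ℂ | 9 / 10 < s.re},
      (1 - (q : ℂ) ^ (-s)) * (1 - χ (q : ZMod D) * (q : ℂ) ^ (-s)) ≠ 0 := by
    intro s hs
    have hs' : 9 / 10 < s.re := hs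
    have hz : ‖(q : ℂ) ^ (-s)‖ < 1 := by
      rw [Complex.norm_natCast_cpow_of_pos hq.pos, Complex.neg_re]
      exact Real.rpow_lt_one_of_one_lt_of_neg (by exact_mod_cast hq.one_lt) (by linarith)
    refine mul_ne_zero ?_ (one_sub_ne_zero_of_norm_lt (DirichletCharacter.norm_le_one χ _) hz)
    have := one_sub_ne_zero_of_norm_lt (w := 1) (by simp) hz
    simpa using this
  unfold calM1Factor
  refine DifferentiableOn.mul (DifferentiableOn.div ?_ ?_ hden) ?_
  · exact ((differentiableOn_const _).sub (hcpow _)).mul ((differentiableOn_const _).sub (hcpow _))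
  · exact ((differentiableOn_const _).sub hcpow0).mul
      ((differentiableOn_const _).sub ((differentiableOn_const _).mul hcpow0))
  · exact (differentiableOn_const _).add
      ((differentiableOn_const _).mul (differentiableOn_xi1LocalSeries c' χ hq d l))

/-! ## Products of holomorphic factors close to `1` -/

/-- `‖∏_{i∈A} g(i) − 1‖ ≤ exp(Σ_{i∈A} ‖g(i) − 1‖) − 1` (Mathlib's
`Finset.norm_prod_one_add_sub_one_le`). [folklore] -/
private theorem norm_prod_sub_one_le {ι : Type*} (A : Finset ι) (g : ι → ℂ) :
    ‖∏ i ∈ A, g i - 1‖ ≤ Real.exp (∑ i ∈ A, ‖g i - 1‖) - 1 := by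
  have h := A.norm_prod_one_add_sub_one_le (fun i => g i - 1)
  simpa only [add_sub_cancel] using h

/-- Tail control for an unconditional product (as in `AppendixAEqA4`): `∏' F = a`, `b ≥ 0` summable,
`‖F(i) − 1‖ ≤ b(i)` off `S` ⇒ `‖a − ∏_S F‖ ≤ ‖∏_S F‖·(exp(Σ' b) − 1)`. [folklore] -/
private theorem norm_hasProd_sub_prod_le {ι : Type*} {F : ι → ℂ} {a : ℂ} (hF : HasProd F a)
    (S : Finset ι) {b : ι → ℝ} (hb0 : ∀ i, 0 ≤ b i) (hb : Summable b)
    (hFb : ∀ i ∉ S, ‖F i - 1‖ ≤ b i) :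
    ‖a - ∏ i ∈ S, F i‖ ≤ ‖∏ i ∈ S, F i‖ * (Real.exp (∑' i, b i) - 1) := by
  classical
  set P := ∏ i ∈ S, F i with hPdef
  set R := ‖P‖ * (Real.exp (∑' i, b i) - 1) with hRdef
  have hA : ∀ A : Finset ι, S ≤ A → ‖∏ i ∈ A, F i - P‖ ≤ R := by
    intro A hSA
    have hsplit : ∏ i ∈ A, F i = P * ∏ i ∈ A \ S, F i := by
      rw [hPdef, ← Finset.prod_sdiff hSA, mul_comm]
    have h1 : ‖∏ i ∈ A \ S, F i - 1‖ ≤ Real.exp (∑' i, b i) - 1 := by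
      refine (norm_prod_sub_one_le _ _).trans ?_
      have hle : ∑ i ∈ A \ S, ‖F i - 1‖ ≤ ∑' i, b i :=
        calc ∑ i ∈ A \ S, ‖F i - 1‖ ≤ ∑ i ∈ A \ S, b i :=
              Finset.sum_le_sum fun i hi => hFb i (Finset.mem_sdiff.mp hi).2
          _ ≤ ∑' i, b i := hb.sum_le_tsum _ (fun i _ => hb0 i)
      linarith [Real.exp_le_exp.mpr hle]
    calc ‖∏ i ∈ A, F i - P‖ = ‖P * (∏ i ∈ A \ S, F i - 1)‖ := by rw [hsplit]; ring_nf
      _ = ‖P‖ * ‖∏ i ∈ A \ S, F i - 1‖ := norm_mul _ _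
      _ ≤ R := mul_le_mul_of_nonneg_left h1 (norm_nonneg _)
  have hT : Tendsto (fun A : Finset ι => ∏ i ∈ A, F i) atTop (𝓝 a) := hF
  have hclosed : IsClosed {z : ℂ | ‖z - P‖ ≤ R} :=
    isClosed_le (continuous_id.sub continuous_const).norm continuous_const
  exact hclosed.mem_of_tendsto hT (Filter.eventually_atTop.mpr ⟨S, fun A hA' => hA A hA'⟩)

/-- **A product of holomorphic factors close to `1` is holomorphic.** If each `F_i` is holomorphic on
an open `U ⊆ ℂ`, `b ≥ 0` is summable and `‖F_i(s) − 1‖ ≤ b_i` for all `i` and `s ∈ U`, then for every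
`s ∈ U` the product `∏'_i F_i(s)` converges (Mathlib `multipliable_one_add_of_summable`) and
`s ↦ ∏'_i F_i(s)` is holomorphic on `U`: the finite partial products converge UNIFORMLY on `U`
(`‖∏' − ∏_A‖ ≤ e^{Σ'b}(e^{Σ_{i∉A} b_i} − 1) → 0`), so `TendstoLocallyUniformlyOn.differentiableOn`
applies. [folklore] -/
private theorem differentiableOn_tprod_of_summable_bound {ι : Type*} {U : Set ℂ} (hU : IsOpen U)
    {F : ι → ℂ → ℂ} {b : ι → ℝ} (hF : ∀ i, DifferentiableOn ℂ (F i) U) (hb0 : ∀ i, 0 ≤ b i)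
    (hb : Summable b) (hFb : ∀ i, ∀ s ∈ U, ‖F i s - 1‖ ≤ b i) :
    (∀ s ∈ U, Multipliable fun i => F i s) ∧ DifferentiableOn ℂ (fun s => ∏' i, F i s) U := by
  classical
  -- pointwise convergence
  have hmul : ∀ s ∈ U, Multipliable fun i => F i s := by
    intro s hs
    have hsum : Summable fun i => ‖F i s - 1‖ :=
      Summable.of_nonneg_of_le (fun _ => norm_nonneg _) (fun i => hFb i s hs) hb
    have h := multipliable_one_add_of_summable hsum
    simpa only [add_sub_cancel] using h
  refine ⟨hmul, ?_⟩
  -- the uniform estimate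
  set B : ℝ := ∑' i, b i with hBdef
  set T : Finset ι → ℝ := fun A => ∑' i, ((↑A : Set ι)ᶜ).indicator b i with hTdef
  have hest : ∀ (A : Finset ι), ∀ s ∈ U,
      ‖(∏' i, F i s) - ∏ i ∈ A, F i s‖ ≤ Real.exp B * (Real.exp (T A) - 1) := by
    intro A s hs
    have hind0 : ∀ i, 0 ≤ ((↑A : Set ι)ᶜ).indicator b i := fun i =>
      Set.indicator_nonneg (fun j _ => hb0 j) i
    have hind : ∀ i ∉ A, ‖F i s - 1‖ ≤ ((↑A : Set ι)ᶜ).indicator b i := by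
      intro i hi
      rw [Set.indicator_of_mem (by simpa using hi)]
      exact hFb i s hs
    have h1 := norm_hasProd_sub_prod_le (hmul s hs).hasProd A hind0 (hb.indicator _) hind
    have hP : ‖∏ i ∈ A, F i s‖ ≤ Real.exp B := by
      have h2 := norm_prod_sub_one_le A (fun i => F i s)
      have h3 : ∑ i ∈ A, ‖F i s - 1‖ ≤ B :=
        calc ∑ i ∈ A, ‖F i s - 1‖ ≤ ∑ i ∈ A, b i := Finset.sum_le_sum fun i _ => hFb i s hs
          _ ≤ B := hb.sum_le_tsum _ (fun i _ => hb0 i)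
      have h4 : ‖∏ i ∈ A, F i s‖ ≤ ‖∏ i ∈ A, F i s - 1‖ + ‖(1 : ℂ)‖ := by
        have := norm_add_le (∏ i ∈ A, F i s - 1) 1
        rwa [sub_add_cancel] at this
      rw [norm_one] at h4
      linarith [Real.exp_le_exp.mpr h3]
    have hT0 : 0 ≤ Real.exp (T A) - 1 := by
      have : 0 ≤ T A := tsum_nonneg hind0
      linarith [Real.add_one_le_exp (T A)]
    calc ‖(∏' i, F i s) - ∏ i ∈ A, F i s‖ ≤ ‖∏ i ∈ A, F i s‖ * (Real.exp (T A) - 1) := h1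
      _ ≤ Real.exp B * (Real.exp (T A) - 1) := mul_le_mul_of_nonneg_right hP hT0
  -- the tail sums tend to `0`
  have hTlim : Tendsto T atTop (𝓝 0) := by
    have h := tendsto_tsum_compl_atTop_zero b
    refine h.congr fun A => ?_
    rw [hTdef]
    exact (tsum_subtype ((↑A : Set ι)ᶜ) b)
  have hglim : Tendsto (fun A => Real.exp B * (Real.exp (T A) - 1)) atTop (𝓝 0) := by
    have h1 : Tendsto (fun A => Real.exp (T A)) atTop (𝓝 (Real.exp 0)) :=
      (Real.continuous_exp.tendsto 0).comp hTlim
    rw [Real.exp_zero] at h1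
    have h2 : Tendsto (fun A => Real.exp (T A) - 1) atTop (𝓝 (1 - 1)) := h1.sub_const 1
    rw [sub_self] at h2
    simpa using h2.const_mul (Real.exp B)
  -- uniform convergence of the partial products on `U`
  have hunif : TendstoUniformlyOn (fun A s => ∏ i ∈ A, F i s) (fun s => ∏' i, F i s) atTop U := by
    rw [Metric.tendstoUniformlyOn_iff]
    intro ε hε
    filter_upwards [hglim.eventually (gt_mem_nhds hε)] with A hA s hs
    rw [dist_eq_norm]
    exact (hest A s hs).trans_lt hA
  refine hunif.tendstoLocallyUniformlyOn.differentiableOn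
    (Filter.Eventually.of_forall fun A => ?_) hU
  exact DifferentiableOn.fun_finsetProd fun i _ => hF i

/-! ## The edge `§15.u034 (analyticity) ⇐ §15.u032 ∧ §15.u033` -/

/-- **`𝓜₁(d,l;·)` converges and is holomorphic on `σ > 9/10`, from the two local estimates**
(DAG `Z22:§15.u034`, analyticity part; [Z22 p.84, tex L4205–L4212]): with
`b_q = C₃₂⁺q^{−19/10} + [q ∣ dl]C₃₃⁺q^{−9/10}` (summable: `Σq^{−19/10} < ∞`, finitely many `q ∣ dl`),
`Step15_u032`/`Step15_u033` give `‖calM1Factor(q;d,l;s) − 1‖ ≤ b_q` for every prime `q` and every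
`σ > 9/10`; each factor is holomorphic (`differentiableOn_calM1Factor`), so
`differentiableOn_tprod_of_summable_bound` applies to `calM1 = ∏'_q calM1Factor`.
[cite: Zhang2022LandauSiegel, §15 p. 84] -/
theorem step15_u034an_of (c' : ℝ) (h32 : Step15_u032 c') (h33 : Step15_u033 c') :
    Step15_u034an c' := by
  classical
  obtain ⟨C₂, h32⟩ := h32
  obtain ⟨C₃, h33⟩ := h33
  obtain ⟨D₀, hD₀⟩ := h32.and h33
  refine ⟨D₀, fun D _ χ hD hq hp hA d l hd hl => ?_⟩
  obtain ⟨e32, e33⟩ := hD₀ D χ hD hq hp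
  have hdl0 : 0 < d * l := Nat.mul_pos hd hl
  set C₂' : ℝ := max C₂ 0 with hC₂'
  set C₃' : ℝ := max C₃ 0 with hC₃'
  -- the majorant over the primes
  set b : Nat.Primes → ℝ := fun q =>
    C₂' * ((q : ℕ) : ℝ) ^ (-(19 / 10 : ℝ)) +
      (if (q : ℕ) ∣ d * l then C₃' * ((q : ℕ) : ℝ) ^ (-(9 / 10 : ℝ)) else 0) with hb
  have hb0 : ∀ q, 0 ≤ b q := fun q => by
    simp only [hb]; split_ifs <;> positivity
  -- summability: the `q^{−19/10}` part over all primes, the `q ∣ dl` part finitely supported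
  have hb1 : Summable fun q : Nat.Primes => C₂' * ((q : ℕ) : ℝ) ^ (-(19 / 10 : ℝ)) := by
    have h : Summable fun n : ℕ => (n : ℝ) ^ (-(19 / 10 : ℝ)) :=
      Real.summable_nat_rpow.mpr (by norm_num)
    exact (h.comp_injective Subtype.val_injective).mul_left C₂'
  set S₂ : Finset Nat.Primes := (d * l).primeFactors.subtype Nat.Prime with hS₂def
  have hb2 : Summable fun q : Nat.Primes =>
      (if (q : ℕ) ∣ d * l then C₃' * ((q : ℕ) : ℝ) ^ (-(9 / 10 : ℝ)) else 0) := by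
    refine summable_of_ne_finset_zero (s := S₂) fun q hq' => ?_
    have hndvd : ¬ (q : ℕ) ∣ d * l := fun h =>
      hq' (Finset.mem_subtype.mpr (Nat.mem_primeFactors.mpr ⟨q.prop, h, hdl0.ne'⟩))
    rw [if_neg hndvd]
  have hbsum : Summable b := hb1.add hb2
  -- the factor bounds on the half-plane
  have hFb : ∀ q : Nat.Primes, ∀ s ∈ {s : ℂ | 9 / 10 < s.re},
      ‖calM1Factor c' χ (q : ℕ) d l s - 1‖ ≤ b q := by
    intro q s hs
    have hs' : 9 / 10 < s.re := hs
    have hqprime : (q : ℕ).Prime := q.prop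
    have hq0 : (0 : ℝ) < ((q : ℕ) : ℝ) := by exact_mod_cast hqprime.pos
    have hnn1 : 0 ≤ C₂' * ((q : ℕ) : ℝ) ^ (-(19 / 10 : ℝ)) := by positivity
    by_cases hc : Nat.Coprime (q : ℕ) (d * l)
    · have h := e32 hA (q : ℕ) d l hqprime hd hl hc s hs'
      have h' : ‖calM1Factor c' χ (q : ℕ) d l s - 1‖ ≤ C₂' * ((q : ℕ) : ℝ) ^ (-(19 / 10 : ℝ)) :=
        h.trans (mul_le_mul_of_nonneg_right (le_max_left _ _) (Real.rpow_nonneg hq0.le _))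
      have hnn2 : 0 ≤ (if (q : ℕ) ∣ d * l then C₃' * ((q : ℕ) : ℝ) ^ (-(9 / 10 : ℝ)) else 0) := by
        split_ifs <;> positivity
      simp only [hb]
      linarith
    · have h := e33 hA (q : ℕ) d l hqprime hd hl hc s hs'
      have hdvd : (q : ℕ) ∣ d * l := not_not.mp (mt hqprime.coprime_iff_not_dvd.mpr hc)
      have h' : ‖calM1Factor c' χ (q : ℕ) d l s - 1‖ ≤ C₃' * ((q : ℕ) : ℝ) ^ (-(9 / 10 : ℝ)) :=
        h.trans (mul_le_mul_of_nonneg_right (le_max_left _ _) (Real.rpow_nonneg hq0.le _))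
      simp only [hb, if_pos hdvd]
      linarith
  have hfac : ∀ q : Nat.Primes,
      DifferentiableOn ℂ (fun s => calM1Factor c' χ (q : ℕ) d l s) {s : ℂ | 9 / 10 < s.re} :=
    fun q => differentiableOn_calM1Factor c' χ q.prop d l
  obtain ⟨hmul, hdiff⟩ := differentiableOn_tprod_of_summable_bound isOpen_U hfac hb0 hbsum hFb
  exact ⟨fun s hs => hmul s hs, hdiff⟩

end Literature.NumberTheory.LFunctions.Zhang2022.Typed.Section15B

end
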